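import Literature.MathematicalPhysics.QuantumFieldTheory.Balaban1983to89.Beta.OneStepKernelFamily

/-!
# `BalabanUV.Beta.DecimationRate` — the block-contour decimation SHARPENS the decay rate by the blocking factor:
# `Decays K C δ ⇒ Decays (dec M K) (C·e^{4δ(d+1)M}) (δ·M)`, and the UNIT-SCALE transport for `KInvStep Lc j`
# (asymptotic lane asym1, gen 15, v1; generic `d`; elementary kernel calculus; HOME-staged certified draft, β-lead RULING (R34-2)(ii))

HONEST FRAMING (cell contract, verbatim): «discharging `BetaPertH` makes Bałaban's UV stability UNCONDITIONAL — a real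
constructive-QFT result; it is NOT the continuum limit and NOT the Clay problem.»  THIS MODULE is the triangle inequality on `ℤ^{d+1}`
and one finite sum; it formalises NO statement printed in Bałaban's papers, cites none as a hypothesis, mints no `Prop` fact, instantiates
NO binder of the wall (`HOME/BETA/WALL.md`) and DISCHARGES NOTHING of it.  NOT summit progress.

ABSOLUTE RULE (cell, verbatim): «No internally-minted statement may enter as a cited fact. Every hypothesis is either
kernel-proved in this package or a verbatim quotation of a PUBLISHED theorem with page reference. The manuscript(s) under
audit are NOT citable for their own disputed steps — they are the thing under adjudication; programme-internal
(2001/route/tribunal) claims are never citable.»  Every theorem below is kernel-proved from explicit, abstract hypotheses.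

PLACEMENT.  A derived CELL RESULT about the cell's typed objects (β-lead RULING (R34-2)), hence the registered cell topic
`Summits/QuantumFields/BalabanUV/Beta/`; it imports one `Literature/…/Balaban1983to89/Beta/` leaf and is imported by nothing under
`Literature/`.  Filed (if at all) by a literature-prover COURIER on behalf of the planner seat asym1 (RULING (R34-A)).

WHY.  The in-tree transport `OneStepKernelFamily.decays_dec : Decays K C δ → Decays (dec M K) (C·e^{4δ(d+1)M}) δ` keeps the FINE rate `δ`
against the COARSE distance `|x′ − y′|₁`: its reverse triangle inequality `l1_sub_le_legPt` discards the factor `M` of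
`|M•x′ − M•y′|₁ = M·|x′ − y′|₁` (`ExpKernelCalculus.l1_natSmul`).  Keeping it gives the rate `δ·M` on the `M`-times coarser lattice with the SAME
constant (`decays_dec_rate`; the in-tree lemma is its `OneStepResolventKernel.decays_mono` corollary, `δ ≤ δ·M` for `M ≥ 1` — not restated here).  Consequence for the decimated composite
resolvent `KInvStep Lc j := dec (Lc^j) (KInv (Lc^(j+1)))` (`decays_KInvStep_unitScale`): a decay of the packed composite resolvent at blocking
`N = Lc^(j+1)` at the UNIT-SCALE rate `δ₀ / Lc^(j+1)` per fine site with constant `C` transports to a decay of `KInvStep Lc j` on the step-`j`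
lattice at rate `δ₀ / Lc` with constant `C·e^{4(d+1)δ₀/Lc}` — BOTH INDEPENDENT OF `j`.  This is the rate half of the `j`-UNIFORMITY asked by the
binders `hK : ∀ j, Decays (… KInvStep Lc j …) C δK` / `hKall` of the (CONV-C-Cauchy) ENDs (`HessKerDressedLimit.d1Drift_JsBalOf_iff_of_cauchy`,
`BalabanUV.Beta.HessKerDressedUnitsWall.d1Drift_JsBalOf_iff_of_cauchy_unit`; memo `HOME/BETA/ASYM-beta.md` §6 O-asym1-1), recorded by the cell's
literature seat as «crude transport constants j-dependent — budget note» (XREAD C-lit2g22-6, INFO I4).  The AMPLITUDE half (which leg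
normalisation makes `C` uniform — the `D = diag(M⁻¹ ∣ M^{−(d+1)})` bookkeeping of `BalabanStepJetsSucc`'s UNITS paragraph) is NOT touched here:
it is the suppliers' (an2 (P4) ∕ an4 (R1)) and GAPS Q-asym1-8.  Whether `KInv (Lc^(j+1))` decays at the unit-scale rate is a HYPOTHESIS below
(`hK`), never asserted.  [folklore] = elementary finite-sum / kernel calculus.
-/

open Finset
open scoped BigOperators
open Literature.MathematicalPhysics.QuantumFieldTheory.Balaban1983to89
open Literature.MathematicalPhysics.QuantumFieldTheory.Balaban1983to89.Beta
open B12Sec2to5 (l1 l1_nonneg)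
open ExpKernelCalculus (Decays l1_sub_triangle l1_sub_symm l1_natSmul)
open OneStepResolventKernel (Fib KInv)
open OneStepKernelFamily (legSet legPt legW dec legW_nonneg sum_legW l1_legPt_sub_le KInvStep)

namespace Summit.QuantumFields.BalabanUV.Beta.DecimationRate

variable {d : ℕ}

/-! ## §1 The sharp reverse triangle inequality and the rate-sharpening transport -/

/-- **SHARP REVERSE TRIANGLE INEQUALITY** for the decimation legs: `M·|x′ − y′|₁ ≤ |p − q|₁ + 4(d+1)M` for leg points `p`, `q` over
`x′`, `y′` (the in-tree `OneStepKernelFamily.l1_sub_le_legPt` is this with the factor `M` on the left dropped). [folklore] -/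
theorem natCast_mul_l1_sub_le_legPt (M : ℕ) (a b : Fib d) (x' y' : Fin (d + 1) → ℤ) {i i' : (Fin (d + 1) → ℕ) × ℕ}
    (hi : i ∈ legSet d M a) (hi' : i' ∈ legSet d M b) :
    (M : ℝ) * l1 (x' - y') ≤ l1 (legPt M a x' i - legPt M b y' i') + 4 * (d + 1) * M := by
  set p := legPt M a x' i
  set q := legPt M b y' i'
  have h1 : (M : ℝ) * l1 (x' - y') = l1 ((M : ℤ) • x' - (M : ℤ) • y') := by
    rw [← smul_sub, l1_natSmul]
  have h2 : l1 ((M : ℤ) • x' - (M : ℤ) • y') ≤ l1 ((M : ℤ) • x' - p) + l1 (p - q) + l1 (q - (M : ℤ) • y') :=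
    (l1_sub_triangle _ p _).trans (by have := l1_sub_triangle p q ((M : ℤ) • y'); linarith)
  have h3 : l1 ((M : ℤ) • x' - p) ≤ 2 * (d + 1) * M := by rw [l1_sub_symm]; exact l1_legPt_sub_le M a x' hi
  have h4 : l1 (q - (M : ℤ) • y') ≤ 2 * (d + 1) * M := l1_legPt_sub_le M b y' hi'
  linarith

/-- **DECIMATION SHARPENS THE DECAY RATE BY THE BLOCKING FACTOR**: a kernel decaying at rate `δ` per site of the fine lattice decimates,
by the factor `M ≥ 1`, to a kernel decaying at rate `δ·M` per site of the coarse lattice, constant multiplied by `e^{4δ(d+1)M}` (the same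
constant as the in-tree `decays_dec`, which records only the rate `δ`). [folklore] -/
theorem decays_dec_rate {K : ExpKernelCalculus.MKer (d + 1) (Fib d)} {C δ : ℝ} (hK : Decays K C δ) (hC : 0 ≤ C) (hδ : 0 ≤ δ)
    {M : ℕ} (hM : 1 ≤ M) : Decays (dec M K) (C * Real.exp (δ * (4 * (d + 1) * M))) (δ * M) := by
  intro x' y' a b
  have hM0 : M ≠ 0 := by omega
  show |∑ i ∈ legSet d M a, ∑ i' ∈ legSet d M b, legW d M a * legW d M b * K (legPt M a x' i) (legPt M b y' i') a b| ≤ _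
  calc |∑ i ∈ legSet d M a, ∑ i' ∈ legSet d M b, legW d M a * legW d M b * K (legPt M a x' i) (legPt M b y' i') a b|
      ≤ ∑ i ∈ legSet d M a, ∑ i' ∈ legSet d M b, |legW d M a * legW d M b * K (legPt M a x' i) (legPt M b y' i') a b| := by
        refine (Finset.abs_sum_le_sum_abs _ _).trans (Finset.sum_le_sum fun i _ => Finset.abs_sum_le_sum_abs _ _)
    _ ≤ ∑ i ∈ legSet d M a, ∑ i' ∈ legSet d M b,
          legW d M a * legW d M b * (C * Real.exp (δ * (4 * (d + 1) * M)) * Real.exp (-(δ * M) * l1 (x' - y'))) := by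
        refine Finset.sum_le_sum fun i hi => Finset.sum_le_sum fun i' hi' => ?_
        rw [abs_mul, abs_mul, abs_of_nonneg (legW_nonneg M a), abs_of_nonneg (legW_nonneg M b)]
        refine mul_le_mul_of_nonneg_left ?_ (mul_nonneg (legW_nonneg M a) (legW_nonneg M b))
        refine (hK _ _ a b).trans ?_
        rw [mul_assoc, ← Real.exp_add]
        refine mul_le_mul_of_nonneg_left (Real.exp_le_exp.2 ?_) hC
        have h := natCast_mul_l1_sub_le_legPt M a b x' y' hi hi'
        have h' := mul_le_mul_of_nonneg_left h hδ
        nlinarith [h', hδ, l1_nonneg (x' - y'), l1_nonneg (legPt M a x' i - legPt M b y' i')]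
    _ = (∑ _i ∈ legSet d M a, legW d M a) * (∑ _i' ∈ legSet d M b, legW d M b) *
          (C * Real.exp (δ * (4 * (d + 1) * M)) * Real.exp (-(δ * M) * l1 (x' - y'))) := by
        rw [Finset.sum_mul_sum, Finset.sum_mul]
        exact Finset.sum_congr rfl fun i _ => by rw [Finset.sum_mul]
    _ = C * Real.exp (δ * (4 * (d + 1) * M)) * Real.exp (-(δ * M) * l1 (x' - y')) := by
        rw [sum_legW hM0 a, sum_legW hM0 b]
        ring

/-! ## §2 The decimated composite resolvent `KInvStep Lc j`: quantitative and unit-scale transport -/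

section Step

variable {Lc : ℕ} [NeZero Lc]

/-- **QUANTITATIVE TRANSPORT** for `KInvStep Lc j = dec (Lc^j) (KInv (Lc^(j+1)))`: a decay of the packed composite resolvent at blocking
`Lc^(j+1)` with constant `C` and fine rate `δ` gives a decay of `KInvStep Lc j` on the step-`j` lattice with constant `C·e^{4δ(d+1)Lc^j}` and
rate `δ·Lc^j`.  (The in-tree `OneStepKernelFamily.decays_KInvStep` is the `∃ δ C` shadow of this with rate `δ`.) [folklore] -/
theorem decays_KInvStep_rate {C δ : ℝ} (j : ℕ) (hK : Decays (KInv (N := Lc ^ (j + 1)) (d := d)) C δ) (hC : 0 ≤ C) (hδ : 0 ≤ δ) :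
    Decays (KInvStep (d := d) Lc j) (C * Real.exp (δ * (4 * (d + 1) * (Lc ^ j : ℕ)))) (δ * (Lc ^ j : ℕ)) :=
  decays_dec_rate hK hC hδ (Nat.one_le_iff_ne_zero.2 (pow_ne_zero _ (NeZero.ne Lc)))

/-- **UNIT-SCALE TRANSPORT — the `j`-UNIFORM shape.**  IF the packed composite resolvent at blocking `N = Lc^(j+1)` decays at the
UNIT-SCALE rate `δ₀ / Lc^(j+1)` per fine site with constant `C` (a HYPOTHESIS — the located, η-uniform propagator content of the series is the
suppliers' to instantiate; nothing is asserted), THEN `KInvStep Lc j` decays on the step-`j` lattice at rate `δ₀ / Lc` with constant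
`C·e^{4(d+1)δ₀/Lc}`: constant AND rate independent of `j`. [folklore] -/
theorem decays_KInvStep_unitScale {C δ₀ : ℝ} (j : ℕ) (hC : 0 ≤ C) (hδ₀ : 0 ≤ δ₀)
    (hK : Decays (KInv (N := Lc ^ (j + 1)) (d := d)) C (δ₀ / (Lc : ℝ) ^ (j + 1))) :
    Decays (KInvStep (d := d) Lc j) (C * Real.exp (4 * (d + 1) * δ₀ / Lc)) (δ₀ / Lc) := by
  have hLc : (0 : ℝ) < Lc := by exact_mod_cast Nat.pos_of_ne_zero (NeZero.ne Lc)
  have hLj : (Lc : ℝ) ^ j ≠ 0 := pow_ne_zero _ hLc.ne'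
  have h := decays_KInvStep_rate (d := d) j hK hC (by positivity)
  have e1 : δ₀ / (Lc : ℝ) ^ (j + 1) * ((Lc ^ j : ℕ) : ℝ) = δ₀ / Lc := by
    rw [Nat.cast_pow, pow_succ, mul_comm ((Lc : ℝ) ^ j) (Lc : ℝ), div_mul_eq_mul_div, mul_div_mul_right _ _ hLj]
  have e2 : δ₀ / (Lc : ℝ) ^ (j + 1) * (4 * (d + 1) * ((Lc ^ j : ℕ) : ℝ)) = 4 * (d + 1) * δ₀ / Lc := by
    rw [← mul_assoc, mul_comm (δ₀ / (Lc : ℝ) ^ (j + 1)) (4 * (d + 1)), mul_assoc, e1, mul_div_assoc]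
  intro x y a b
  have hxy := h x y a b
  rw [e1, e2] at hxy
  exact hxy

/-- The same transport for a decay hypothesis stated with the real power `(Lc : ℝ)^j`-free form `δ₀ / N` at `N = Lc^(j+1)` cast as a natural
number (the shape in which an `N`-indexed resolvent bound is usually stated). [folklore] -/
theorem decays_KInvStep_unitScale' {C δ₀ : ℝ} (j : ℕ) (hC : 0 ≤ C) (hδ₀ : 0 ≤ δ₀)
    (hK : Decays (KInv (N := Lc ^ (j + 1)) (d := d)) C (δ₀ / ((Lc ^ (j + 1) : ℕ) : ℝ))) :
    Decays (KInvStep (d := d) Lc j) (C * Real.exp (4 * (d + 1) * δ₀ / Lc)) (δ₀ / Lc) := by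
  rw [Nat.cast_pow] at hK
  exact decays_KInvStep_unitScale j hC hδ₀ hK

end Step

end Summit.QuantumFields.BalabanUV.Beta.DecimationRate
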